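import Literature.NumberTheory.Automorphic.UnitaryCurveCohCotangentForms
import Literature.NumberTheory.Automorphic.UnitaryGroupCohomologicalForms
import Literature.NumberTheory.Automorphic.UnitaryGroupArchSection
import Literature.NumberTheory.Automorphic.UnitaryGroupLevelTransport
import Literature.NumberTheory.Automorphic.SmoothRepresentation
import HarnessLib

/-!
# Spectral projection of CONE-holomorphic cotangent forms and the cotangent isotypic line of a discrete automorphic representation of a
# unitary group `U(H)` IN TWO VARIABLES — the rank-2 SCALAR twins of ★ `UnitaryGroupCotangentSpectralProjection` (letters (D), (E) of the
# floor-0 engine), over the CONE carriers of ★ `UnitaryCurveCohCotangentForms`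

Topic `NumberTheory/Automorphic`; namespace `Literature.NumberTheory.Automorphic.UnitaryCurveForms` (the carriers' namespace).  STATEMENT-ONLY:
four closed named facts `def … : Prop` (no `sorry`, no instance, no notation, no new carrier).  HONEST DEBT: +4 named facts, 0 carriers.  Imports ★
`UnitaryCurveCohCotangentForms` (`holCotForms₂ … 𝔣`, `conjFun₂`, `rightRep₂`, `ConeFrame`, §5 `DiscreteAutomorphicRep.ContainsFun`), ★
`UnitaryGroupCohomologicalForms` §4 (`toQuotFun`), ★ `UnitaryGroupArchSection` §3 (`cmPlace`, `IsCMField.complexConj_ne_one`,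
`complexConj_smul_infinitePlace`), ★ `UnitaryGroupLevelTransport` (`formCongr`), ★ `SmoothRepresentation` (`IsSmooth`).

SETTING (binder prefix UNIFORM with ★-pending `Rogawski1990/CurveCohomologicalSpectrum`, copied token for token from the crux letter `S1BettiShape`
of `Summits/…/Cruxes/HLiu418/Lines/F0_AlbCm.lean`): `L` CM with `[L:ℚ] ≥ 4`, `ι : L →+* ℂ`, `H ∈ M₂(L)` DIAGONALISED over `L` up to a scalar
(`formCongr c g (t • H) = diag dV`, `dV` real non-zero) of SIGNATURE `(1,1)` at `ι` (`∃ T ∈ GL₂(ℂ)`, `formCongr conj T (ι(diag dV)) = diag(1,−1)`) and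
DEFINITE at the other complex places (`(τ′(diag dV)).PosDef`); `𝒰 := adelicGroupData L⁺ L c̄ 2 H`, `μ` an automorphic measure on its (compact)
quotient, a CONE FRAME `𝔣 : ConeFrame L H (cmPlace L ι)` (a negative vector and an orthogonal positive one for `σ_{w(ι)}H`), `P : DiscreteAutomorphicRep 𝒰 μ`,
`pr_P = P.space.toSubmodule.starProjection` the orthogonal projection of `L²` onto `P` (Mathlib `Submodule.starProjection`), and the class
`MemLp.toLp (toQuotFun 𝒰 f) _` of a SCALAR form `f : 𝒰.Adelic → ℂ` read on the automorphic quotient (as in `ContainsFun`).  The HOLOMORPHIC COTANGENT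
FORMS are the members of `holCotForms₂ L⁺ L c̄ H hc hfix (cmPlace L ι) 𝔣` — left `U(H)(L⁺)`-invariant, right-invariant under the compact archimedean factor
`K_c` away from `ι`, smooth under `U(H)(𝔸_{L⁺,f})`, and CONE-HOLOMORPHIC at `ι`: the `w(ι)`-slice through every adelic point is (the restriction to
`U(σ_{w(ι)}H)` of) a function holomorphic on the cone-open `{g ∈ GL₂(ℂ) | g v₀ negative}` obeying the cotangent law `Φ(g b) = (a k⁻¹) Φ(g)` along the
stabiliser of the line `ℂ v₀` — i.e. the `(1,0)` cotangent forms of all levels on the unitary Shimura curves of `U(H)` read on the adelic group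
([Borel1997, §5.13–§5.14]; [BorelWallach2000, VII 2.10]); the antiholomorphic ones are their `conjFun₂`-images.

* (D₂) `holCotFormSpectralProjection₂` / `antiholCotFormSpectralProjection₂` (TP⁺, ONE class) **U**: the projection onto `P` of the class of a
  square-integrable holomorphic (resp. antiholomorphic) cotangent form `f` is the class of ONE holomorphic (resp. antiholomorphic) cotangent form `f_P`
  (possibly `0`).  READING (= ★ (D) at rank 2, one coordinate instead of two): `pr_P` commutes with the right regular action of `U(H)(𝔸_{L⁺})`
  ([BorelJacquet1979, §4.6]; [DeitmarEchterhoff2014, Thm. 7.3.2]) — hence with right `K_c`-, `K_f`- and `K_∞ = Stab_{U(σ_ι H)}(ℂ v₀)`-translations (it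
  preserves left `U(H)(L⁺)`-invariance, `K_c`-invariance, smoothness, and the cotangent `K_∞`-CHARACTER `a k⁻¹` of the cone law) — and, on smooth vectors,
  with the derived action of `𝔤 = Lie U(1,1)` ([BorelWallach2000, XIII 1.2]); a cone-holomorphic cotangent form is `𝔭⁻`-annihilated ([Borel1997, §5.14:
  holomorphy of the form ⟺ the Cauchy–Riemann / lowering-operator condition on the group function]) and `K_∞`-finite, hence `𝒵(𝔤)`-finite, so its
  projection is a `K_∞`-finite `𝒵`-finite class, represented by a unique ANALYTIC function ([Borel1997, Thm. 2.13 and §8.4 remark] — stated there for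
  `SL₂(ℝ)`, of which `U(1,1)(ℝ)` is a central modification; [HarishChandra1968]), again `𝔭⁻`-annihilated, i.e. cone-holomorphic with the same law.
* (E₂) `cohIsotypicLine₂_hol` / `cohIsotypicLine₂_antihol` (E1″₂) **U**: for `σ` an IRREDUCIBLE SMOOTH representation of `U(H)(𝔸_{L⁺,f})`, the
  `U(H)(𝔸_{L⁺,f})`-equivariant linear maps `ψ : σ → (U(H)(𝔸_{L⁺}) → ℂ)` (equivariance for ★ `rightRep₂`) with values holomorphic (resp. antiholomorphic)
  cotangent forms CONTAINED IN `P` (`P.ContainsFun (ψ w)`) lie on ONE LINE.  READING (= ★ (E) at rank 2): such `ψ` embed (classes; unique continuous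
  representatives) into `Hom_{U(H)(𝔸_{L⁺,f})}(σ, P_f^∞)` through the ONE copy of the cotangent `K_∞`-character `a k⁻¹` among the `K_c`-fixed
  `𝔭⁻`-annihilated vectors of `P_∞` (`P ≅ P_∞ ⊗̂ P_f`, [Flath1979, §2], [BorelJacquet1979, §4.6]; in the holomorphic discrete series of `U(1,1)` generated
  by a lowest-weight vector the lowest `K_∞`-type occurs ONCE — it is `U(𝔭⁺)·v` and `𝔭⁺` shifts the `K_∞`-character, [Borel1997, §2 and §15: structure of
  the discrete series of `SL₂(ℝ)`]; [BorelWallach2000, VI 4.11, VII 3.2]; [Liu2021, App. D §D.1 after Lem. D.1: the two cohomological `π^{1,0}_{1,1}`,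
  `π^{0,1}_{1,1}`]), a space of dimension `≤ 1` by Schur's lemma ([BushnellHenniart2006, §2.6]: a non-zero map out of the irreducible `σ` is an
  isomorphism onto the irreducible admissible `P_f^∞`, whose commutant is `ℂ` — no admissibility of `σ` is needed, as in the rank-3 letter).
The `MemLp` of `f` enters (D₂) as a HYPOTHESIS binder (the realised forms of the record tower are continuous on the compact quotient — the consumer's
junction files).  Consumed by: the P5 slice of `stub_S1_betti` (F0P5-p03: closers of `stub_L10`/`stub_L01`/`stub_X` of `Lines/F0_AlbCmS1Betti` over these
letters, ★-pending `Rogawski1990/CurveCohomologicalSpectrum` and ★-pending `Theorems/HLiu418ScalarSpectralJunction`).  Cell `hodgecm-mathlib`,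
floor-0 programme P5, seat F0P5-p02 (g0).  HC_CM is proved only modulo the printed citations until rung 0 closes; this file discharges none of them.

ED. 3 (desk ruling R1 (α-lite) ∕ road (i′), F0P5-plan (g0) 2026-08-31T02:17:57Z + 02:30:56Z; bytes F0P5-p03 (g2) for the letter's owner F0P5-p02): the two
(D₂) letters gain ONE hypothesis `(H.map (cmPlace L ι).1.embedding).IsHermitian →` right after the diagonalisation — their honest domain (hermitian
`σ_{w(ι)}H`; see the docstrings) and, token for token, the statement at which the analytic sub-line `Summits/…/Cruxes/HLiu418/Lines/F0_P5TP2SpectralProjection.lean`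
PROVES (D₂)⁺ (reproducing kernel on the cone, `L²` orbit regularity, Cauchy–Riemann on the slice); the NAMES are unchanged and every importer re-elaborates
unchanged (all application sites go through the shape-robust ★ `UnitaryCurveCotangentSpectralProjectionHerm` ∕ ★ `…Conj` ed. 2).  The (E₂) letters are
untouched (they are kernel theorems as typed: ★ `Summits/…/Theorems/HLiu418E2LevelFinite`, F0P5-p02 (g2)).  Net debt unchanged (the two (D₂) facts become
WEAKER declared hypotheses).

## References
* [BorelJacquet1979] A. Borel, H. Jacquet, Corvallis PSPM 33.1 (1979), §4.3 (automorphic forms: `K`-finite, `𝒵`-finite), §4.6 (`L²_d`, `π ≅ π_∞ ⊗ π_f`).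
* [Borel1997] A. Borel, *Automorphic forms on SL₂(ℝ)*, Cambridge Tracts 130 (1997): Thm. 2.13 and the §8.4 remark (regularity: `𝒵`-finite `K`-finite
  ⇒ analytic; held scan chunks p0020, p0065), §5.13–§5.14 (forms of weight `m` as functions on the group; holomorphy), §15 (discrete series).
* [HarishChandra1968] Harish-Chandra, *Automorphic forms on semisimple Lie groups*, LNM 62 (1968) (regularity of `K`-finite `𝒵`-finite functions).
* [BorelWallach2000] A. Borel, N. Wallach, 2nd ed. (2000), VI 4.11, VII 2.10, 3.2, 3.6, XIII 1.2.
* [DeitmarEchterhoff2014] A. Deitmar, S. Echterhoff, *Principles of Harmonic Analysis*, 2nd ed. (2014), Thm. 7.3.2.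
* [Flath1979] D. Flath, Corvallis PSPM 33.1 (1979), §2.  [BushnellHenniart2006] C. Bushnell, G. Henniart, Grundlehren 335 (2006), §2.6 (Schur's lemma).
* [Liu2021] Y. Liu, Camb. J. Math. 9 (2021) = arXiv:2102.11518, App. D §D.1 (after Lem. D.1) and §D.3 (the two cohomological `π_∞` of `U(V)(ℝ)`; held
  chunks p0057 L13–16, p0058 L25–29).
-/

noncomputable section

open NumberField NumberField.InfinitePlace MeasureTheory
open scoped Matrix ComplexOrder

namespace Literature.NumberTheory.Automorphic.UnitaryCurveForms

open Literature.NumberTheory.Automorphic.UnitaryGroup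
open Literature.NumberTheory.Automorphic.UnitaryGroup.CotangentForms (toQuotFun)

/-- **U** (D₂, holomorphic) **Spectral projection of a cone-holomorphic cotangent form is a cone-holomorphic cotangent form (TP⁺, one class).**
In the rank-2 setting (`L` CM with `[L:ℚ] ≥ 4`, `H ∈ M₂(L)` with `formCongr c g (t • H) = diag dV`, signature `(1,1)` at `ι` and definite elsewhere read
on `diag dV`, `μ` automorphic, `𝔣` a cone frame at the place of `ι`): for every discrete automorphic `P` and every `f ∈ holCotForms₂ … 𝔣` whose value on
the quotient (`toQuotFun`) is square-integrable, there is `f′ ∈ holCotForms₂ … 𝔣`, square-integrable, such that the orthogonal projection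
`P.space.toSubmodule.starProjection` of the class of `f` is the class of `f′`.  READING: `pr_P` is `U(H)(𝔸_{L⁺})`-equivariant ([BorelJacquet1979, §4.6];
[DeitmarEchterhoff2014, Thm. 7.3.2]) and commutes with `𝔤` on smooth vectors ([BorelWallach2000, XIII 1.2]); the projected class is `K_∞`-finite of the
cotangent character, `K_c`- and `K_f`-invariant, `𝒵`-finite and `𝔭⁻`-annihilated, hence represented by a unique analytic cone-holomorphic cotangent form
([Borel1997, Thm. 2.13, §5.14 and §8.4 remark]; [HarishChandra1968]).  Rank-3 twin: ★ `CotangentForms.holCotFormSpectralProjection`.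
[cite: BorelJacquet1979, §4.6] [cite: Borel1997, Thm. 2.13, §5.14 and §8.4] [cite: HarishChandra1968] [cite: BorelWallach2000, XIII 1.2; VII 2.10]
[cite: DeitmarEchterhoff2014, Thm. 7.3.2]
HONEST DOMAIN (ed. 3): the hypothesis `(H.map (cmPlace L ι).1.embedding).IsHermitian` right after the diagonalisation restricts the statement to HERMITIAN
`σ_{w(ι)}H` — `formCongr c g (t • H) = diag dV` only makes `t • H` `c`-hermitian, and for `t ∉ L⁺` (`ι t ∉ ℝ`) the matrix `σ_{w(ι)}H = (ι t)⁻¹ • K` (`K`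
hermitian) is not hermitian, a case the sources do not state in this form ([BorelJacquet1979, §4.6] and [Borel1997] concern the unitary group of a hermitian
form, [PlatonovRapinchuk1994, §2.3]) and no consumer uses (all hold `(ι t).im = 0`, whence the hypothesis; they apply the letter through ★
`holCotFormSpectralProjection₂.apply_herm` of ★ `UnitaryCurveCotangentSpectralProjectionHerm`). [cite: PlatonovRapinchuk1994, §2.3] -/
def holCotFormSpectralProjection₂ : Prop :=
  ∀ (L : Type) [Field L] [NumberField L] [IsCMField L] (ι : L →+* ℂ) (H : Matrix (Fin 2) (Fin 2) L)
    (dV : Fin 2 → L) (_hdV : ∀ i, IsCMField.complexConj L (dV i) = dV i) (_hdV0 : ∀ i, dV i ≠ 0)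
    (t : L) (_ht : t ≠ 0) (g : GL (Fin 2) L),
    formCongr ((IsCMField.complexConj L : L ≃ₐ[↥(maximalRealSubfield L)] L) : L →+* L) g (t • H) = Matrix.diagonal dV →
    (H.map (cmPlace L ι).1.embedding).IsHermitian →
    (∃ T : GL (Fin 2) ℂ, formCongr (starRingEnd ℂ) T ((Matrix.diagonal dV).map ι) = Matrix.diagonal ![(1 : ℂ), -1]) →
    (∀ τ' : L →+* ℂ, InfinitePlace.mk τ' ≠ InfinitePlace.mk ι → ((Matrix.diagonal dV).map τ').PosDef) →
    4 ≤ Module.finrank ℚ L →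
    ∀ (𝔣 : ConeFrame L H (cmPlace L ι))
      (μ : Measure (adelicGroupData (↥(maximalRealSubfield L)) L (IsCMField.complexConj L) 2 H).automorphicQuotient)
      [(adelicGroupData (↥(maximalRealSubfield L)) L (IsCMField.complexConj L) 2 H).IsAutomorphicMeasure μ]
      (P : DiscreteAutomorphicRep (adelicGroupData (↥(maximalRealSubfield L)) L (IsCMField.complexConj L) 2 H) μ)
      (f : (adelicGroupData (↥(maximalRealSubfield L)) L (IsCMField.complexConj L) 2 H).Adelic → ℂ),
      f ∈ holCotForms₂ (↥(maximalRealSubfield L)) L (IsCMField.complexConj L) H (IsCMField.complexConj_ne_one L)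
          (UnitaryGroup.complexConj_smul_infinitePlace L) (cmPlace L ι) 𝔣 →
    ∀ hf : MemLp (toQuotFun (adelicGroupData (↥(maximalRealSubfield L)) L (IsCMField.complexConj L) 2 H) f) 2 μ,
      ∃ f' ∈ holCotForms₂ (↥(maximalRealSubfield L)) L (IsCMField.complexConj L) H (IsCMField.complexConj_ne_one L)
          (UnitaryGroup.complexConj_smul_infinitePlace L) (cmPlace L ι) 𝔣,
        ∃ hf' : MemLp (toQuotFun (adelicGroupData (↥(maximalRealSubfield L)) L (IsCMField.complexConj L) 2 H) f') 2 μ,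
          P.space.toSubmodule.starProjection
              (MemLp.toLp (toQuotFun (adelicGroupData (↥(maximalRealSubfield L)) L (IsCMField.complexConj L) 2 H) f) hf) =
            MemLp.toLp (toQuotFun (adelicGroupData (↥(maximalRealSubfield L)) L (IsCMField.complexConj L) 2 H) f') hf'

/-- **U** (D₂, antiholomorphic) **Spectral projection of a cone-ANTIholomorphic cotangent form is a cone-antiholomorphic cotangent form** — the statement of
`holCotFormSpectralProjection₂` with `(holCotForms₂ … 𝔣).map (conjFun₂ …)` (complex conjugates: `K_∞`-character `ā k̄⁻¹`, `𝔭⁺`-annihilated) in place of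
`holCotForms₂ … 𝔣`; same reading.  Rank-3 twin: ★ `CotangentForms.antiholCotFormSpectralProjection`. [cite: BorelJacquet1979, §4.6]
[cite: Borel1997, Thm. 2.13, §5.14 and §8.4] [cite: HarishChandra1968] [cite: BorelWallach2000, XIII 1.2; VII 2.10] [cite: DeitmarEchterhoff2014, Thm. 7.3.2]
HONEST DOMAIN (ed. 3): as for `holCotFormSpectralProjection₂`, the hypothesis `(H.map (cmPlace L ι).1.embedding).IsHermitian` after the diagonalisation
(consumers apply the letter through ★ `antiholCotFormSpectralProjection₂.apply_herm`). [cite: PlatonovRapinchuk1994, §2.3] -/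
def antiholCotFormSpectralProjection₂ : Prop :=
  ∀ (L : Type) [Field L] [NumberField L] [IsCMField L] (ι : L →+* ℂ) (H : Matrix (Fin 2) (Fin 2) L)
    (dV : Fin 2 → L) (_hdV : ∀ i, IsCMField.complexConj L (dV i) = dV i) (_hdV0 : ∀ i, dV i ≠ 0)
    (t : L) (_ht : t ≠ 0) (g : GL (Fin 2) L),
    formCongr ((IsCMField.complexConj L : L ≃ₐ[↥(maximalRealSubfield L)] L) : L →+* L) g (t • H) = Matrix.diagonal dV →
    (H.map (cmPlace L ι).1.embedding).IsHermitian →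
    (∃ T : GL (Fin 2) ℂ, formCongr (starRingEnd ℂ) T ((Matrix.diagonal dV).map ι) = Matrix.diagonal ![(1 : ℂ), -1]) →
    (∀ τ' : L →+* ℂ, InfinitePlace.mk τ' ≠ InfinitePlace.mk ι → ((Matrix.diagonal dV).map τ').PosDef) →
    4 ≤ Module.finrank ℚ L →
    ∀ (𝔣 : ConeFrame L H (cmPlace L ι))
      (μ : Measure (adelicGroupData (↥(maximalRealSubfield L)) L (IsCMField.complexConj L) 2 H).automorphicQuotient)
      [(adelicGroupData (↥(maximalRealSubfield L)) L (IsCMField.complexConj L) 2 H).IsAutomorphicMeasure μ]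
      (P : DiscreteAutomorphicRep (adelicGroupData (↥(maximalRealSubfield L)) L (IsCMField.complexConj L) 2 H) μ)
      (f : (adelicGroupData (↥(maximalRealSubfield L)) L (IsCMField.complexConj L) 2 H).Adelic → ℂ),
      f ∈ (holCotForms₂ (↥(maximalRealSubfield L)) L (IsCMField.complexConj L) H (IsCMField.complexConj_ne_one L)
          (UnitaryGroup.complexConj_smul_infinitePlace L) (cmPlace L ι) 𝔣).map
        (conjFun₂ (↥(maximalRealSubfield L)) L (IsCMField.complexConj L) H) →
    ∀ hf : MemLp (toQuotFun (adelicGroupData (↥(maximalRealSubfield L)) L (IsCMField.complexConj L) 2 H) f) 2 μ,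
      ∃ f' ∈ (holCotForms₂ (↥(maximalRealSubfield L)) L (IsCMField.complexConj L) H (IsCMField.complexConj_ne_one L)
          (UnitaryGroup.complexConj_smul_infinitePlace L) (cmPlace L ι) 𝔣).map
        (conjFun₂ (↥(maximalRealSubfield L)) L (IsCMField.complexConj L) H),
        ∃ hf' : MemLp (toQuotFun (adelicGroupData (↥(maximalRealSubfield L)) L (IsCMField.complexConj L) 2 H) f') 2 μ,
          P.space.toSubmodule.starProjection
              (MemLp.toLp (toQuotFun (adelicGroupData (↥(maximalRealSubfield L)) L (IsCMField.complexConj L) 2 H) f) hf) =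
            MemLp.toLp (toQuotFun (adelicGroupData (↥(maximalRealSubfield L)) L (IsCMField.complexConj L) 2 H) f') hf'

/-- **U** (E₂, holomorphic) **The holomorphic cotangent isotypic line of a discrete `P` (rank 2, E1″₂).**  In the rank-2 setting, for an IRREDUCIBLE SMOOTH
representation `σ` of `U(H)(𝔸_{L⁺,f})` on `W` and a discrete automorphic `P`, the `U(H)(𝔸_{L⁺,f})`-equivariant linear maps
`ψ : W → (U(H)(𝔸_{L⁺}) → ℂ)` (equivariance for the right translation ★ `rightRep₂`) all of whose values are cone-holomorphic cotangent forms CONTAINED IN `P`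
(`P.ContainsFun (ψ w)`) lie on one line: there is `ψ₀` of which every such `ψ` is a scalar multiple.  READING: such `ψ` embed (classes; unique continuous
representatives) into `Hom_{U(H)(𝔸_{L⁺,f})}(σ, P_f^∞)` through the one copy of the cotangent `K_∞`-character among the `K_c`-fixed `𝔭⁻`-annihilated vectors of
`P_∞` (`P ≅ P_∞ ⊗̂ P_f`, [Flath1979, §2], [BorelJacquet1979, §4.6]; the lowest `K_∞`-type of a holomorphic discrete series representation of `U(1,1)` occurs
once, [Borel1997, §15]; [BorelWallach2000, VI 4.11, VII 3.2]; [Liu2021, App. D §D.1/§D.3: `π^{1,0}_{1,1}`]), a space of dimension `≤ 1` by Schur's lemma for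
irreducible smooth representations of countable dimension ([BushnellHenniart2006, §2.6]; the target `P_f^∞` is irreducible admissible).  Rank-3
twin: ★ `CotangentForms.cohIsotypicLine_hol` (same hypotheses on `σ`). [cite: Flath1979, §2] [cite: BorelJacquet1979, §4.6] [cite: Borel1997, §15]
[cite: BorelWallach2000, VI 4.11; VII 3.2 and 3.6] [cite: BushnellHenniart2006, §2.6] [cite: Liu2021, App. D §D.1 and §D.3 (the two cohomological `π_∞`)] -/
def cohIsotypicLine₂_hol : Prop :=
  ∀ (L : Type) [Field L] [NumberField L] [IsCMField L] (ι : L →+* ℂ) (H : Matrix (Fin 2) (Fin 2) L)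
    (dV : Fin 2 → L) (_hdV : ∀ i, IsCMField.complexConj L (dV i) = dV i) (_hdV0 : ∀ i, dV i ≠ 0)
    (t : L) (_ht : t ≠ 0) (g : GL (Fin 2) L),
    formCongr ((IsCMField.complexConj L : L ≃ₐ[↥(maximalRealSubfield L)] L) : L →+* L) g (t • H) = Matrix.diagonal dV →
    (∃ T : GL (Fin 2) ℂ, formCongr (starRingEnd ℂ) T ((Matrix.diagonal dV).map ι) = Matrix.diagonal ![(1 : ℂ), -1]) →
    (∀ τ' : L →+* ℂ, InfinitePlace.mk τ' ≠ InfinitePlace.mk ι → ((Matrix.diagonal dV).map τ').PosDef) →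
    4 ≤ Module.finrank ℚ L →
    ∀ (𝔣 : ConeFrame L H (cmPlace L ι))
      (μ : Measure (adelicGroupData (↥(maximalRealSubfield L)) L (IsCMField.complexConj L) 2 H).automorphicQuotient)
      [(adelicGroupData (↥(maximalRealSubfield L)) L (IsCMField.complexConj L) 2 H).IsAutomorphicMeasure μ]
      (W : Type) [AddCommGroup W] [Module ℂ W]
      (σ : Representation ℂ (finAdelic (↥(maximalRealSubfield L)) L (IsCMField.complexConj L) 2 H) W),
      σ.IsIrreducible → σ.IsSmooth →
    ∀ P : DiscreteAutomorphicRep (adelicGroupData (↥(maximalRealSubfield L)) L (IsCMField.complexConj L) 2 H) μ,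
      ∃ ψ₀ : W →ₗ[ℂ] ((adelicGroupData (↥(maximalRealSubfield L)) L (IsCMField.complexConj L) 2 H).Adelic → ℂ),
        ∀ ψ : W →ₗ[ℂ] ((adelicGroupData (↥(maximalRealSubfield L)) L (IsCMField.complexConj L) 2 H).Adelic → ℂ),
          (∀ (g : finAdelic (↥(maximalRealSubfield L)) L (IsCMField.complexConj L) 2 H) (w : W),
              ψ (σ g w) = rightRep₂ (↥(maximalRealSubfield L)) L (IsCMField.complexConj L) H g (ψ w)) →
          (∀ w : W, ψ w ∈ holCotForms₂ (↥(maximalRealSubfield L)) L (IsCMField.complexConj L) H (IsCMField.complexConj_ne_one L)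
              (UnitaryGroup.complexConj_smul_infinitePlace L) (cmPlace L ι) 𝔣 ∧ P.ContainsFun (ψ w)) →
            ∃ r : ℂ, ψ = r • ψ₀

/-- **U** (E₂, antiholomorphic) **The antiholomorphic cotangent isotypic line of a discrete `P` (rank 2)** — the statement of `cohIsotypicLine₂_hol` with values in
`(holCotForms₂ … 𝔣).map (conjFun₂ …)`; same reading (the other cohomological representation `π^{0,1}_{1,1}`, character `ā k̄⁻¹`).  Rank-3 twin: ★
`CotangentForms.cohIsotypicLine_antihol`. [cite: Flath1979, §2] [cite: BorelJacquet1979, §4.6] [cite: Borel1997, §15]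
[cite: BorelWallach2000, VI 4.11; VII 2.10, 3.2 and 3.6] [cite: BushnellHenniart2006, §2.6] [cite: Liu2021, App. D §D.1 and §D.3 (the two cohomological `π_∞`)] -/
def cohIsotypicLine₂_antihol : Prop :=
  ∀ (L : Type) [Field L] [NumberField L] [IsCMField L] (ι : L →+* ℂ) (H : Matrix (Fin 2) (Fin 2) L)
    (dV : Fin 2 → L) (_hdV : ∀ i, IsCMField.complexConj L (dV i) = dV i) (_hdV0 : ∀ i, dV i ≠ 0)
    (t : L) (_ht : t ≠ 0) (g : GL (Fin 2) L),
    formCongr ((IsCMField.complexConj L : L ≃ₐ[↥(maximalRealSubfield L)] L) : L →+* L) g (t • H) = Matrix.diagonal dV →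
    (∃ T : GL (Fin 2) ℂ, formCongr (starRingEnd ℂ) T ((Matrix.diagonal dV).map ι) = Matrix.diagonal ![(1 : ℂ), -1]) →
    (∀ τ' : L →+* ℂ, InfinitePlace.mk τ' ≠ InfinitePlace.mk ι → ((Matrix.diagonal dV).map τ').PosDef) →
    4 ≤ Module.finrank ℚ L →
    ∀ (𝔣 : ConeFrame L H (cmPlace L ι))
      (μ : Measure (adelicGroupData (↥(maximalRealSubfield L)) L (IsCMField.complexConj L) 2 H).automorphicQuotient)
      [(adelicGroupData (↥(maximalRealSubfield L)) L (IsCMField.complexConj L) 2 H).IsAutomorphicMeasure μ]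
      (W : Type) [AddCommGroup W] [Module ℂ W]
      (σ : Representation ℂ (finAdelic (↥(maximalRealSubfield L)) L (IsCMField.complexConj L) 2 H) W),
      σ.IsIrreducible → σ.IsSmooth →
    ∀ P : DiscreteAutomorphicRep (adelicGroupData (↥(maximalRealSubfield L)) L (IsCMField.complexConj L) 2 H) μ,
      ∃ ψ₀ : W →ₗ[ℂ] ((adelicGroupData (↥(maximalRealSubfield L)) L (IsCMField.complexConj L) 2 H).Adelic → ℂ),
        ∀ ψ : W →ₗ[ℂ] ((adelicGroupData (↥(maximalRealSubfield L)) L (IsCMField.complexConj L) 2 H).Adelic → ℂ),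
          (∀ (g : finAdelic (↥(maximalRealSubfield L)) L (IsCMField.complexConj L) 2 H) (w : W),
              ψ (σ g w) = rightRep₂ (↥(maximalRealSubfield L)) L (IsCMField.complexConj L) H g (ψ w)) →
          (∀ w : W, ψ w ∈ (holCotForms₂ (↥(maximalRealSubfield L)) L (IsCMField.complexConj L) H (IsCMField.complexConj_ne_one L)
              (UnitaryGroup.complexConj_smul_infinitePlace L) (cmPlace L ι) 𝔣).map
                (conjFun₂ (↥(maximalRealSubfield L)) L (IsCMField.complexConj L) H) ∧
            P.ContainsFun (ψ w)) →
            ∃ r : ℂ, ψ = r • ψ₀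

end Literature.NumberTheory.Automorphic.UnitaryCurveForms

end
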